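import Mathlib.Algebra.Polynomial.Derivative
import Mathlib.Algebra.Polynomial.BigOperators
import Mathlib.LinearAlgebra.Matrix.Determinant.Basic
import Literature.RingTheory.MvPolynomial.KaltofenNoetherFormsGeneric
import HarnessLib

/-!
# Towards Kaltofen's Theorem 7 (effective Noether forms): proofs — coefficient-norm bookkeeping

Sibling proof file of `KaltofenNoetherForms.lean` / `KaltofenNoetherFormsGeneric.lean`
(E. Kaltofen, J. Comput. System Sci. 50 (1995) 274–295). Kaltofen's size estimates (§3, §5) rest
on two properties of the 1-norm: "`‖φψ‖₁ ≤ ‖φ‖₁‖ψ‖₁`, `‖φ + ψ‖₁ ≤ ‖φ‖₁ + ‖ψ‖₁`" (§3 p. 10), used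
for polynomials in any number of (nested) variables, and the minor-expansion bound for
determinants ("by Cramer's rule and minor expansion on the arising determinants", proof of
Lemma 1; "`N! ≤ (2d)^{3N}`", proof of Thm. 4). This file proves them for the norms `polyNorm ν`,
`mvNorm ν` of `KaltofenNoetherFormsGeneric` relative to an arbitrary sub-additive,
sub-multiplicative `ν : R → ℕ` with `ν 0 = 0` (hypotheses passed explicitly), together with the
bounds for sums, products, powers, coefficients, derivatives and determinants.
No definitions, no named facts.

## References

* E. Kaltofen, J. Comput. System Sci. 50 (1995) 274–295, §3 (1-norms), Lemma 1, Thm. 4.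
  [Kaltofen1995]
-/

noncomputable section

open scoped Polynomial

namespace Literature.RingTheory.MvPolynomial

namespace KaltofenGeneric

/-! ### Norms of sums in a normed ring -/

section RingNorm

variable {R : Type*} (ν : R → ℕ)

/-- `ν(Σ aᵢ) ≤ Σ ν(aᵢ)` for a sub-additive `ν` with `ν 0 = 0`. [cite: Kaltofen1995, §3 (1-norms)] -/
theorem norm_sum_le [AddCommMonoid R] (h0 : ν 0 = 0) (hadd : ∀ a b, ν (a + b) ≤ ν a + ν b)
    {ι : Type*} (s : Finset ι) (a : ι → R) : ν (∑ i ∈ s, a i) ≤ ∑ i ∈ s, ν (a i) := by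
  classical
  induction s using Finset.induction_on with
  | empty => simp [h0]
  | insert i s hi ih =>
    rw [Finset.sum_insert hi, Finset.sum_insert hi]
    exact (hadd _ _).trans (Nat.add_le_add_left ih _)

-- `ν(∏ aᵢ) ≤ ∏ ν(aᵢ)` for a sub-multiplicative `ν` with `ν 1 ≤ 1` (Kaltofen1995, §3 (1-norms)) is
-- Mathlib's `Finset.le_prod_of_submultiplicative`; it is used directly below.

/-- `ν(aᵏ) ≤ ν(a)ᵏ`. [cite: Kaltofen1995, §3 (1-norms)] -/
theorem norm_pow_le [Monoid R] (h1 : ν 1 ≤ 1) (hmul : ∀ a b, ν (a * b) ≤ ν a * ν b) (a : R) (k : ℕ) :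
    ν (a ^ k) ≤ ν a ^ k := by
  induction k with
  | zero => simpa using h1
  | succ k ih => rw [pow_succ, pow_succ]; exact (hmul _ _).trans (Nat.mul_le_mul_right _ ih)

/-- `ν(k • a) ≤ k ν(a)`. [folklore] -/
theorem norm_nsmul_le [AddMonoid R] (h0 : ν 0 = 0) (hadd : ∀ a b, ν (a + b) ≤ ν a + ν b) (a : R)
    (k : ℕ) : ν (k • a) ≤ k * ν a := by
  induction k with
  | zero => simp [h0]
  | succ k ih => rw [succ_nsmul, Nat.succ_mul]; exact (hadd _ _).trans (Nat.add_le_add_right ih _)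

/-- **Minor-expansion bound for determinants:** `ν(det M) ≤ Σ_σ ∏ᵢ ν(M_{σ i, i})`, for `ν`
sub-additive, sub-multiplicative, with `ν(-a) = ν(a)`. [cite: Kaltofen1995, §3 (proof of Lemma 1, "minor expansion")] -/
theorem norm_det_le_sum_perm [CommRing R] (h0 : ν 0 = 0) (h1 : ν 1 ≤ 1)
    (hadd : ∀ a b, ν (a + b) ≤ ν a + ν b) (hmul : ∀ a b, ν (a * b) ≤ ν a * ν b)
    (hneg : ∀ a, ν (-a) = ν a) {ι : Type*} [Fintype ι] [DecidableEq ι] (M : Matrix ι ι R) :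
    ν M.det ≤ ∑ σ : Equiv.Perm ι, ∏ i, ν (M (σ i) i) := by
  rw [Matrix.det_apply]
  refine (norm_sum_le ν h0 hadd _ _).trans (Finset.sum_le_sum fun σ _ => ?_)
  have hsign : ν (Equiv.Perm.sign σ • ∏ i, M (σ i) i) = ν (∏ i, M (σ i) i) := by
    rcases Int.units_eq_one_or (Equiv.Perm.sign σ) with h | h
    · rw [h, one_smul]
    · rw [h, Units.neg_smul, one_smul, hneg]
  rw [hsign]
  exact Finset.le_prod_of_submultiplicative ν h1 hmul _ _

/-- **Determinant bound by a uniform entry bound:** if every entry has `ν ≤ W` then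
`ν(det M) ≤ |ι|! W^{|ι|}`. [cite: Kaltofen1995, §3 (proof of Thm. 4, "N! ≤ (2d)^{3N}")] -/
theorem norm_det_le_factorial_mul_pow [CommRing R] (h0 : ν 0 = 0) (h1 : ν 1 ≤ 1)
    (hadd : ∀ a b, ν (a + b) ≤ ν a + ν b) (hmul : ∀ a b, ν (a * b) ≤ ν a * ν b)
    (hneg : ∀ a, ν (-a) = ν a) {ι : Type*} [Fintype ι] [DecidableEq ι] (M : Matrix ι ι R) {W : ℕ}
    (hW : ∀ i j, ν (M i j) ≤ W) :
    ν M.det ≤ (Fintype.card ι).factorial * W ^ Fintype.card ι := by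
  refine (norm_det_le_sum_perm ν h0 h1 hadd hmul hneg M).trans ?_
  calc ∑ σ : Equiv.Perm ι, ∏ i, ν (M (σ i) i) ≤ ∑ _σ : Equiv.Perm ι, W ^ Fintype.card ι := by
        refine Finset.sum_le_sum fun σ _ => ?_
        calc ∏ i, ν (M (σ i) i) ≤ ∏ _i : ι, W :=
              Finset.prod_le_prod (fun i _ => Nat.zero_le _) fun i _ => hW _ _
          _ = W ^ Fintype.card ι := by rw [Finset.prod_const, Finset.card_univ]
    _ = (Fintype.card ι).factorial * W ^ Fintype.card ι := by
        rw [Finset.sum_const, smul_eq_mul, Finset.card_univ, Fintype.card_perm]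

end RingNorm

/-! ### The norm of a univariate polynomial -/

section PolyNorm

variable {R : Type*} [CommRing R] (ν : R → ℕ)

/-- Coefficient-norm bookkeeping (Kaltofen §3, 1-norms): `polyNorm_zero`. [folklore] -/
theorem polyNorm_zero : polyNorm ν (0 : R[X]) = 0 := by
  simp [polyNorm]

/-- The norm as a sum over any finite set containing the support. [folklore] -/
theorem polyNorm_eq_sum_of_support_subset (h0 : ν 0 = 0) (p : R[X]) {s : Finset ℕ}
    (hs : p.support ⊆ s) : polyNorm ν p = ∑ i ∈ s, ν (p.coeff i) := by
  unfold polyNorm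
  refine Finset.sum_subset hs fun i _ hi => ?_
  rw [Polynomial.notMem_support_iff.1 hi, h0]

/-- Coefficient-norm bookkeeping (Kaltofen §3, 1-norms): `polyNorm_monomial`. [folklore] -/
theorem polyNorm_monomial (h0 : ν 0 = 0) (k : ℕ) (a : R) :
    polyNorm ν (Polynomial.monomial k a) = ν a := by
  classical
  rw [polyNorm_eq_sum_of_support_subset ν h0 _ (Polynomial.support_monomial_subset k a),
    Finset.sum_singleton, Polynomial.coeff_monomial, if_pos rfl]

/-- Coefficient-norm bookkeeping (Kaltofen §3, 1-norms): `polyNorm_C`. [folklore] -/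
theorem polyNorm_C (h0 : ν 0 = 0) (a : R) : polyNorm ν (Polynomial.C a) = ν a := by
  rw [← Polynomial.monomial_zero_left, polyNorm_monomial ν h0]

/-- Coefficient-norm bookkeeping (Kaltofen §3, 1-norms): `polyNorm_C_mul_X_pow`. [folklore] -/
theorem polyNorm_C_mul_X_pow (h0 : ν 0 = 0) (a : R) (k : ℕ) :
    polyNorm ν (Polynomial.C a * Polynomial.X ^ k) = ν a := by
  rw [Polynomial.C_mul_X_pow_eq_monomial, polyNorm_monomial ν h0]

/-- Coefficient-norm bookkeeping (Kaltofen §3, 1-norms): `polyNorm_X`. [folklore] -/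
theorem polyNorm_X (h0 : ν 0 = 0) : polyNorm ν (Polynomial.X : R[X]) = ν 1 := by
  rw [← Polynomial.monomial_one_one_eq_X, polyNorm_monomial ν h0]

/-- Each coefficient is bounded by the norm. [folklore] -/
theorem norm_coeff_le_polyNorm (h0 : ν 0 = 0) (p : R[X]) (i : ℕ) : ν (p.coeff i) ≤ polyNorm ν p := by
  classical
  by_cases hi : i ∈ p.support
  · exact Finset.single_le_sum (f := fun i => ν (p.coeff i)) (fun _ _ => Nat.zero_le _) hi
  · rw [Polynomial.notMem_support_iff.1 hi, h0]; exact Nat.zero_le _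

/-- Subadditivity. [cite: Kaltofen1995, §3 (1-norms)] -/
theorem polyNorm_add_le (h0 : ν 0 = 0) (hadd : ∀ a b, ν (a + b) ≤ ν a + ν b) (p q : R[X]) :
    polyNorm ν (p + q) ≤ polyNorm ν p + polyNorm ν q := by
  classical
  rw [polyNorm_eq_sum_of_support_subset ν h0 (p + q) Polynomial.support_add,
    polyNorm_eq_sum_of_support_subset ν h0 p Finset.subset_union_left,
    polyNorm_eq_sum_of_support_subset ν h0 q Finset.subset_union_right, ← Finset.sum_add_distrib]
  exact Finset.sum_le_sum fun i _ => by rw [Polynomial.coeff_add]; exact hadd _ _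

/-- Coefficient-norm bookkeeping (Kaltofen §3, 1-norms): `polyNorm_sum_le`. [folklore] -/
theorem polyNorm_sum_le (h0 : ν 0 = 0) (hadd : ∀ a b, ν (a + b) ≤ ν a + ν b) {ι : Type*}
    (s : Finset ι) (p : ι → R[X]) : polyNorm ν (∑ i ∈ s, p i) ≤ ∑ i ∈ s, polyNorm ν (p i) :=
  norm_sum_le (polyNorm ν) (polyNorm_zero ν) (polyNorm_add_le ν h0 hadd) s p

/-- Submultiplicativity. [cite: Kaltofen1995, §3 (1-norms)] -/
theorem polyNorm_mul_le (h0 : ν 0 = 0) (hadd : ∀ a b, ν (a + b) ≤ ν a + ν b)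
    (hmul : ∀ a b, ν (a * b) ≤ ν a * ν b) (p q : R[X]) :
    polyNorm ν (p * q) ≤ polyNorm ν p * polyNorm ν q := by
  classical
  rw [Polynomial.mul_eq_sum_sum]
  refine (polyNorm_sum_le ν h0 hadd _ _).trans ?_
  calc ∑ i ∈ p.support, polyNorm ν (q.sum fun j a => Polynomial.monomial (i + j) (p.coeff i * a))
      ≤ ∑ i ∈ p.support, ∑ j ∈ q.support, ν (p.coeff i) * ν (q.coeff j) := by
        refine Finset.sum_le_sum fun i _ => ?_
        rw [Polynomial.sum_def]
        refine (polyNorm_sum_le ν h0 hadd _ _).trans (Finset.sum_le_sum fun j _ => ?_)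
        rw [polyNorm_monomial ν h0]
        exact hmul _ _
    _ = polyNorm ν p * polyNorm ν q := by
        rw [polyNorm, polyNorm, Finset.sum_mul_sum]

/-- Coefficient-norm bookkeeping (Kaltofen §3, 1-norms): `polyNorm_one_le`. [folklore] -/
theorem polyNorm_one_le (h0 : ν 0 = 0) (h1 : ν 1 ≤ 1) : polyNorm ν (1 : R[X]) ≤ 1 := by
  rw [← Polynomial.C_1, polyNorm_C ν h0]; exact h1

/-- Coefficient-norm bookkeeping (Kaltofen §3, 1-norms): `polyNorm_prod_le`. [folklore] -/
theorem polyNorm_prod_le (h0 : ν 0 = 0) (h1 : ν 1 ≤ 1) (hadd : ∀ a b, ν (a + b) ≤ ν a + ν b)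
    (hmul : ∀ a b, ν (a * b) ≤ ν a * ν b) {ι : Type*} (s : Finset ι) (p : ι → R[X]) :
    polyNorm ν (∏ i ∈ s, p i) ≤ ∏ i ∈ s, polyNorm ν (p i) :=
  Finset.le_prod_of_submultiplicative (polyNorm ν) (polyNorm_one_le ν h0 h1)
    (polyNorm_mul_le ν h0 hadd hmul) s p

/-- Coefficient-norm bookkeeping (Kaltofen §3, 1-norms): `polyNorm_pow_le`. [folklore] -/
theorem polyNorm_pow_le (h0 : ν 0 = 0) (h1 : ν 1 ≤ 1) (hadd : ∀ a b, ν (a + b) ≤ ν a + ν b)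
    (hmul : ∀ a b, ν (a * b) ≤ ν a * ν b) (p : R[X]) (k : ℕ) :
    polyNorm ν (p ^ k) ≤ polyNorm ν p ^ k :=
  norm_pow_le (polyNorm ν) (polyNorm_one_le ν h0 h1) (polyNorm_mul_le ν h0 hadd hmul) p k

/-- Coefficient-norm bookkeeping (Kaltofen §3, 1-norms): `polyNorm_neg`. [folklore] -/
theorem polyNorm_neg (hneg : ∀ a, ν (-a) = ν a) (p : R[X]) : polyNorm ν (-p) = polyNorm ν p := by
  unfold polyNorm
  rw [Polynomial.support_neg]
  exact Finset.sum_congr rfl fun i _ => by rw [Polynomial.coeff_neg, hneg]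

/-- **Norm of the derivative:** `‖p'‖ ≤ deg p · ‖p‖`. [folklore] -/
theorem polyNorm_derivative_le (h0 : ν 0 = 0) (hadd : ∀ a b, ν (a + b) ≤ ν a + ν b) (p : R[X]) :
    polyNorm ν (Polynomial.derivative p) ≤ p.natDegree * polyNorm ν p := by
  classical
  have hsupp : (Polynomial.derivative p).support ⊆ Finset.range p.natDegree := by
    intro i hi
    rw [Finset.mem_range]
    by_contra h
    rw [Polynomial.mem_support_iff, Polynomial.coeff_derivative,
      Polynomial.coeff_eq_zero_of_natDegree_lt (by omega), zero_mul] at hi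
    exact hi rfl
  rw [polyNorm_eq_sum_of_support_subset ν h0 _ hsupp]
  calc ∑ i ∈ Finset.range p.natDegree, ν ((Polynomial.derivative p).coeff i)
      ≤ ∑ i ∈ Finset.range p.natDegree, p.natDegree * ν (p.coeff (i + 1)) := by
        refine Finset.sum_le_sum fun i hi => ?_
        rw [Finset.mem_range] at hi
        rw [Polynomial.coeff_derivative, ← Nat.cast_succ, ← nsmul_eq_mul']
        exact (norm_nsmul_le ν h0 hadd _ _).trans (Nat.mul_le_mul_right _ (by omega))
    _ = p.natDegree * ∑ i ∈ Finset.range p.natDegree, ν (p.coeff (i + 1)) := by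
        rw [Finset.mul_sum]
    _ ≤ p.natDegree * polyNorm ν p := by
        refine Nat.mul_le_mul_left _ ?_
        have hsupp' : p.support ⊆ Finset.range (p.natDegree + 1) := fun i hi => by
          rw [Finset.mem_range]; exact Nat.lt_succ_of_le (Polynomial.le_natDegree_of_mem_supp _ hi)
        rw [polyNorm_eq_sum_of_support_subset ν h0 p hsupp', Finset.sum_range_succ']
        exact Nat.le_add_right _ _

end PolyNorm

/-! ### The norm of a multivariate polynomial -/

section MvNorm

variable {R : Type*} [CommRing R] {σ : Type*} (ν : R → ℕ)

/-- Coefficient-norm bookkeeping (Kaltofen §3, 1-norms): `mvNorm_zero`. [folklore] -/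
theorem mvNorm_zero : mvNorm ν (0 : MvPolynomial σ R) = 0 := by
  simp [mvNorm]

/-- Coefficient-norm bookkeeping (Kaltofen §3, 1-norms): `mvNorm_eq_sum_of_support_subset`. [folklore] -/
theorem mvNorm_eq_sum_of_support_subset (h0 : ν 0 = 0) (p : MvPolynomial σ R) {s : Finset (σ →₀ ℕ)}
    (hs : p.support ⊆ s) : mvNorm ν p = ∑ m ∈ s, ν (MvPolynomial.coeff m p) := by
  unfold mvNorm
  refine Finset.sum_subset hs fun m _ hm => ?_
  rw [MvPolynomial.notMem_support_iff.1 hm, h0]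

/-- Coefficient-norm bookkeeping (Kaltofen §3, 1-norms): `mvNorm_monomial`. [folklore] -/
theorem mvNorm_monomial (h0 : ν 0 = 0) (m : σ →₀ ℕ) (a : R) :
    mvNorm ν (MvPolynomial.monomial m a) = ν a := by
  classical
  rw [mvNorm_eq_sum_of_support_subset ν h0 _ MvPolynomial.support_monomial_subset,
    Finset.sum_singleton, MvPolynomial.coeff_monomial, if_pos rfl]

/-- Coefficient-norm bookkeeping (Kaltofen §3, 1-norms): `mvNorm_C`. [folklore] -/
theorem mvNorm_C (h0 : ν 0 = 0) (a : R) : mvNorm ν (MvPolynomial.C a : MvPolynomial σ R) = ν a := by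
  rw [MvPolynomial.C_apply, mvNorm_monomial ν h0]

/-- Coefficient-norm bookkeeping (Kaltofen §3, 1-norms): `mvNorm_X`. [folklore] -/
theorem mvNorm_X (h0 : ν 0 = 0) (i : σ) : mvNorm ν (MvPolynomial.X i : MvPolynomial σ R) = ν 1 := by
  rw [MvPolynomial.X, mvNorm_monomial ν h0]

/-- Coefficient-norm bookkeeping (Kaltofen §3, 1-norms): `norm_coeff_le_mvNorm`. [folklore] -/
theorem norm_coeff_le_mvNorm (h0 : ν 0 = 0) (p : MvPolynomial σ R) (m : σ →₀ ℕ) :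
    ν (MvPolynomial.coeff m p) ≤ mvNorm ν p := by
  classical
  by_cases hm : m ∈ p.support
  · exact Finset.single_le_sum (f := fun m => ν (MvPolynomial.coeff m p)) (fun _ _ => Nat.zero_le _) hm
  · rw [MvPolynomial.notMem_support_iff.1 hm, h0]; exact Nat.zero_le _

/-- Coefficient-norm bookkeeping (Kaltofen §3, 1-norms): `mvNorm_add_le`. [folklore] -/
theorem mvNorm_add_le (h0 : ν 0 = 0) (hadd : ∀ a b, ν (a + b) ≤ ν a + ν b) (p q : MvPolynomial σ R) :
    mvNorm ν (p + q) ≤ mvNorm ν p + mvNorm ν q := by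
  classical
  rw [mvNorm_eq_sum_of_support_subset ν h0 (p + q) MvPolynomial.support_add,
    mvNorm_eq_sum_of_support_subset ν h0 p Finset.subset_union_left,
    mvNorm_eq_sum_of_support_subset ν h0 q Finset.subset_union_right, ← Finset.sum_add_distrib]
  exact Finset.sum_le_sum fun m _ => by rw [MvPolynomial.coeff_add]; exact hadd _ _

/-- Coefficient-norm bookkeeping (Kaltofen §3, 1-norms): `mvNorm_sum_le`. [folklore] -/
theorem mvNorm_sum_le (h0 : ν 0 = 0) (hadd : ∀ a b, ν (a + b) ≤ ν a + ν b) {ι : Type*}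
    (s : Finset ι) (p : ι → MvPolynomial σ R) :
    mvNorm ν (∑ i ∈ s, p i) ≤ ∑ i ∈ s, mvNorm ν (p i) :=
  norm_sum_le (mvNorm ν) (mvNorm_zero ν) (mvNorm_add_le ν h0 hadd) s p

/-- Coefficient-norm bookkeeping (Kaltofen §3, 1-norms): `mvNorm_mul_le`. [folklore] -/
theorem mvNorm_mul_le (h0 : ν 0 = 0) (hadd : ∀ a b, ν (a + b) ≤ ν a + ν b)
    (hmul : ∀ a b, ν (a * b) ≤ ν a * ν b) (p q : MvPolynomial σ R) :
    mvNorm ν (p * q) ≤ mvNorm ν p * mvNorm ν q := by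
  classical
  rw [MvPolynomial.mul_def, MvPolynomial.sum_def]
  refine (mvNorm_sum_le ν h0 hadd _ _).trans ?_
  calc ∑ m ∈ p.support, mvNorm ν ((AddMonoidAlgebra.coeff q).sum fun m' b =>
          MvPolynomial.monomial (m + m') (MvPolynomial.coeff m p * b))
      ≤ ∑ m ∈ p.support, ∑ m' ∈ q.support, ν (MvPolynomial.coeff m p) * ν (MvPolynomial.coeff m' q) := by
        refine Finset.sum_le_sum fun m _ => ?_
        rw [MvPolynomial.sum_def]
        refine (mvNorm_sum_le ν h0 hadd _ _).trans (Finset.sum_le_sum fun m' _ => ?_)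
        rw [mvNorm_monomial ν h0]
        exact hmul _ _
    _ = mvNorm ν p * mvNorm ν q := by
        rw [mvNorm, mvNorm, Finset.sum_mul_sum]

/-- Coefficient-norm bookkeeping (Kaltofen §3, 1-norms): `mvNorm_one_le`. [folklore] -/
theorem mvNorm_one_le (h0 : ν 0 = 0) (h1 : ν 1 ≤ 1) : mvNorm ν (1 : MvPolynomial σ R) ≤ 1 := by
  rw [← MvPolynomial.C_1, mvNorm_C ν h0]; exact h1

/-- Coefficient-norm bookkeeping (Kaltofen §3, 1-norms): `mvNorm_prod_le`. [folklore] -/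
theorem mvNorm_prod_le (h0 : ν 0 = 0) (h1 : ν 1 ≤ 1) (hadd : ∀ a b, ν (a + b) ≤ ν a + ν b)
    (hmul : ∀ a b, ν (a * b) ≤ ν a * ν b) {ι : Type*} (s : Finset ι) (p : ι → MvPolynomial σ R) :
    mvNorm ν (∏ i ∈ s, p i) ≤ ∏ i ∈ s, mvNorm ν (p i) :=
  Finset.le_prod_of_submultiplicative (mvNorm ν) (mvNorm_one_le ν h0 h1)
    (mvNorm_mul_le ν h0 hadd hmul) s p

/-- Coefficient-norm bookkeeping (Kaltofen §3, 1-norms): `mvNorm_pow_le`. [folklore] -/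
theorem mvNorm_pow_le (h0 : ν 0 = 0) (h1 : ν 1 ≤ 1) (hadd : ∀ a b, ν (a + b) ≤ ν a + ν b)
    (hmul : ∀ a b, ν (a * b) ≤ ν a * ν b) (p : MvPolynomial σ R) (k : ℕ) :
    mvNorm ν (p ^ k) ≤ mvNorm ν p ^ k :=
  norm_pow_le (mvNorm ν) (mvNorm_one_le ν h0 h1) (mvNorm_mul_le ν h0 hadd hmul) p k

/-- Coefficient-norm bookkeeping (Kaltofen §3, 1-norms): `mvNorm_neg`. [folklore] -/
theorem mvNorm_neg (hneg : ∀ a, ν (-a) = ν a) (p : MvPolynomial σ R) : mvNorm ν (-p) = mvNorm ν p := by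
  unfold mvNorm
  rw [MvPolynomial.support_neg]
  exact Finset.sum_congr rfl fun m _ => by rw [MvPolynomial.coeff_neg, hneg]

end MvNorm

end KaltofenGeneric

end Literature.RingTheory.MvPolynomial

end
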